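import Summits.CriticalPhenomena.PercolationContinuityZ3.Theorems.PercNearOneGluingNoHeavyQuantFarGate3ChartDCertS
import HarnessLib

/-!
# QUANT lane R8, front "FAR beyond trees", layer one — THE DEGREE-THREE GATE AT THE OBSERVER, LIX-e: chart-D kernel — k-d certificate trees and the COVERAGE theorem `ChartD.tree_sound`

builds on p205010 (kernel theorem, internal audit signed; external expert review pending)

Support file (`--supports stmt-CriticalPhenomena-4575`), seat `prim-quant-p1` (gen 32); memo
`run/shared/lean/prim/quant/prim-quant-p1-g32/FOR-LEAD-GATE3-CHARTC.md` §4b (chart D = corner blow-up, file LV).  Standard axioms; no sorries.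
GENERATED by `work/chartc/gen_kernel_d.py` — the chart-C kernel files XLIX, L-a..LI re-instantiated verbatim for the chart-D tables (`kit/chartC/dspec.py`).

Verbatim re-instantiation of file LI over the chart-D checker: `QBox4` in `(σ, u, ε, θ)`, `Tree` (leaf / skip above the hyperbola σu = p₀ / node),
`certContains` (plain containment), `covers`, `cert_apply`, `tree_sound`, `BoxOKD` / `BoxOKDR`.
[this work].
-/

noncomputable section


noncomputable section

namespace Summit.CriticalPhenomena.PercolationContinuityZ3.Theorems

namespace Quant

namespace ChartD

/-- A rational parameter box `[slo, shi] × [ulo, uhi] × [elo, ehi] × [tlo, thi]` in `(σ, u, ε, θ)`. -/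
structure QBox4 where
  slo : ℚ
  shi : ℚ
  ulo : ℚ
  uhi : ℚ
  elo : ℚ
  ehi : ℚ
  tlo : ℚ
  thi : ℚ

/-- Replace the upper (`upper = true`) or lower end of axis `ax` (0 = σ, 1 = u, 2 = ε, 3 = θ) by `t`. -/
def QBox4.cut (B : QBox4) (ax : ℕ) (t : ℚ) (upper : Bool) : QBox4 :=
  match ax, upper with
  | 0, true => { B with shi := t }
  | 0, false => { B with slo := t }
  | 1, true => { B with uhi := t }
  | 1, false => { B with ulo := t }
  | 2, true => { B with ehi := t }
  | 2, false => { B with elo := t }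
  | _, true => { B with thi := t }
  | _, false => { B with tlo := t }

/-- k-d tree of chart-D certificates; `skip` marks a sub-box lying on or above the hyperbola `σu = p₀`. -/
inductive Tree where
  | leaf (c : Cert) : Tree
  | skip : Tree
  | node (ax : ℕ) (t : ℚ) (tlo thi : Tree) : Tree

/-- The certificate's integer `(σ, u, ε, θ)`-box contains the rational box `B`. -/
def certContains (c : Cert) (B : QBox4) : Bool :=
  decide (0 < c.D) && decide ((c.S0 : ℚ) ≤ c.D * B.slo) && decide ((c.D : ℚ) * B.shi ≤ c.S1) &&
    decide ((c.T0 : ℚ) ≤ c.D * B.ulo) && decide ((c.D : ℚ) * B.uhi ≤ c.T1) &&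
    decide ((c.U0 : ℚ) ≤ c.D * B.elo) && decide ((c.D : ℚ) * B.ehi ≤ c.U1) &&
    decide ((c.V0 : ℚ) ≤ c.D * B.tlo) && decide ((c.D : ℚ) * B.thi ≤ c.V1)

/-- The tree `t` covers the box `B` below the hyperbola `σu = p₀` (fuel recursion, for cheap kernel evaluation). -/
def covers (p₀ : ℚ) : ℕ → Tree → QBox4 → Bool
  | 0, _, _ => false
  | _ + 1, Tree.leaf c, B => check c && certContains c B
  | _ + 1, Tree.skip, B => decide (0 ≤ B.slo ∧ 0 ≤ B.ulo ∧ p₀ ≤ B.slo * B.ulo)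
  | fuel + 1, Tree.node ax t tlo thi, B => covers p₀ fuel tlo (B.cut ax t true) && covers p₀ fuel thi (B.cut ax t false)

set_option maxHeartbeats 800000 in
/-- A checked certificate containing the point refutes the chart-D system there (restatement of `ChartC.sound` with the box hypotheses read
off `certContains`). -/
theorem cert_apply (c : Cert) (B : QBox4) (hchk : check c = true) (hcont : certContains c B = true) (σ u ε θ : ℝ)
    (hslo : (B.slo : ℝ) ≤ σ) (hshi : σ ≤ B.shi) (hulo : (B.ulo : ℝ) ≤ u) (huhi : u ≤ B.uhi)
    (h1lo : (B.elo : ℝ) ≤ ε) (h1hi : ε ≤ B.ehi) (h2lo : (B.tlo : ℝ) ≤ θ) (h2hi : θ ≤ B.thi)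
    (hσ0 : 0 < σ) (hu0 : 0 < u) (hσu : σ * u ≤ 1) (hε0 : 0 < ε) (hε1 : ε ≤ 1) (hθ0 : 0 < θ) (hθ1 : θ ≤ 1) :
    ∀ (a0 a1 At B1 B2 c0 c1 D : ℝ), 0 ≤ a0 → 0 ≤ a1 → 0 ≤ At → 0 ≤ B1 → 0 ≤ B2 → 0 ≤ c0 → 0 ≤ c1 → 0 ≤ D →
    0 ≤ (σ * D * (a0 + a1 + σ * u * (ε * θ * At)) - B1 * (u * B2 + (c0 + c1))) →
    0 ≤ (σ * D * (a0 + a1 + σ * u * (ε * θ * At)) - B2 * (u * B1 + (c0 + c1))) →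
    0 ≤ (σ * D * (a0 + a1 + σ * u * (ε * θ * At)) - (c0 + c1) * (B1 + B2)) →
    0 ≤ (σ * D * (a0 + u * B1 + u * B2 + c0) - B1 * (a1 + σ * u * (ε * θ * At) + c1 + σ * u * D)) →
    0 ≤ (σ * D * (a0 + u * B1 + u * B2 + c0) - B2 * (a1 + σ * u * (ε * θ * At) + c1 + σ * u * D)) →
    0 ≤ ((c1 + σ * u * D) * (a0 + u * B1 + u * B2 + c0) - c0 * (a1 + σ * u * (ε * θ * At) + c1 + σ * u * D)) →
    0 < ε * a0 + (-(1 - σ * u)) * At + ε * c0 + (-((1 - σ * u) * ε)) * D →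
    0 < (-(σ * (1 - θ * ε))) * a0 + (-σ) * a1 + (-(σ * θ * (1 - σ * u * (1 - ε)))) * At + (1 - σ * u) * B1 + (-(1 - (1 - σ * u) * (θ * ε))) * B2 + (-(σ * ε * θ)) * c1 →
    0 < (-(σ * (1 - ε))) * a0 + (-σ) * a1 + (-(σ * (1 - σ * u * (1 - θ * ε)))) * At + (-(1 - (1 - σ * u) * ε)) * B1 + (1 - σ * u) * B2 + (-(σ * ε)) * c1 →
    0 < (-(σ * (1 - ε) * (θ * ε))) * a0 + (1 - σ * u * (1 - θ * ε) - σ * θ * ε) * a1 + (-((σ * u + (1 - σ * u) * (1 - ε)) * (θ * ε))) * B1 + (-((σ * u + (1 - σ * u) * (1 - θ * ε)) * ε)) * B2 + (1 - σ * u * (1 - ε * ε * θ) - σ * (ε * ε * θ)) * c1 →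
    0 < (σ * u * (3 - ε - θ * ε) + σ * (1 - θ * ε) - 2) * a0 + (σ * u * (2 - ε) + σ * (1 - θ * ε) - 1) * a1 + (ε * θ * (σ * (σ * u * u * (3 - ε - θ * ε) + 1 - 2 * u))) * At + ((σ * u + (1 - σ * u) * (1 - ε)) * (1 - θ * ε) * (1 + u) - (1 - σ * u) * ε * u) * B1 + ((σ * u + (1 - σ * u) * (1 - θ * ε)) * (1 - ε) * (1 + u) - (1 - σ * u) * (θ * ε) * u) * B2 + (σ * u + (σ + 2 * (σ * u)) * (1 - ε * ε * θ) - 2) * c0 + (σ * u + (σ + σ * u) * (1 - ε * ε * θ) - 1) * c1 + (σ + σ * u - σ * u * ((1 - σ * u) * (ε * ε * θ))) * D →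
    False := by
  simp only [certContains, Bool.and_eq_true, decide_eq_true_eq] at hcont
  obtain ⟨⟨⟨⟨⟨⟨⟨⟨hD, hS0⟩, hS1⟩, hT0⟩, hT1⟩, hU0⟩, hU1⟩, hV0⟩, hV1⟩ := hcont
  have hDpos : (0 : ℝ) < c.D := by exact_mod_cast hD
  have hS0' : ((c.S0 : ℚ) : ℝ) ≤ ((c.D : ℚ) : ℝ) * (B.slo : ℝ) := by exact_mod_cast hS0
  have hS1' : ((c.D : ℚ) : ℝ) * (B.shi : ℝ) ≤ ((c.S1 : ℚ) : ℝ) := by exact_mod_cast hS1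
  have hT0' : ((c.T0 : ℚ) : ℝ) ≤ ((c.D : ℚ) : ℝ) * (B.ulo : ℝ) := by exact_mod_cast hT0
  have hT1' : ((c.D : ℚ) : ℝ) * (B.uhi : ℝ) ≤ ((c.T1 : ℚ) : ℝ) := by exact_mod_cast hT1
  have hU0' : ((c.U0 : ℚ) : ℝ) ≤ ((c.D : ℚ) : ℝ) * (B.elo : ℝ) := by exact_mod_cast hU0
  have hU1' : ((c.D : ℚ) : ℝ) * (B.ehi : ℝ) ≤ ((c.U1 : ℚ) : ℝ) := by exact_mod_cast hU1
  have hV0' : ((c.V0 : ℚ) : ℝ) ≤ ((c.D : ℚ) : ℝ) * (B.tlo : ℝ) := by exact_mod_cast hV0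
  have hV1' : ((c.D : ℚ) : ℝ) * (B.thi : ℝ) ≤ ((c.V1 : ℚ) : ℝ) := by exact_mod_cast hV1
  simp only [Rat.cast_natCast] at hS0' hS1' hT0' hT1' hU0' hU1' hV0' hV1'
  have hD0 := hDpos.le
  exact sound c hchk σ u ε θ hσ0 hu0 hσu hε0 hε1 hθ0 hθ1
    (hS0'.trans (mul_le_mul_of_nonneg_left hslo hD0)) (le_trans (mul_le_mul_of_nonneg_left hshi hD0) hS1')
    (hT0'.trans (mul_le_mul_of_nonneg_left hulo hD0)) (le_trans (mul_le_mul_of_nonneg_left huhi hD0) hT1')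
    (hU0'.trans (mul_le_mul_of_nonneg_left h1lo hD0)) (le_trans (mul_le_mul_of_nonneg_left h1hi hD0) hU1')
    (hV0'.trans (mul_le_mul_of_nonneg_left h2lo hD0)) (le_trans (mul_le_mul_of_nonneg_left h2hi hD0) hV1')

/-- **Coverage theorem.** -/
theorem tree_sound (p₀ : ℚ) : ∀ (fuel : ℕ) (t : Tree) (B : QBox4), covers p₀ fuel t B = true → ∀ (σ u ε θ : ℝ),
    (B.slo : ℝ) ≤ σ → σ ≤ B.shi → (B.ulo : ℝ) ≤ u → u ≤ B.uhi → (B.elo : ℝ) ≤ ε → ε ≤ B.ehi → (B.tlo : ℝ) ≤ θ → θ ≤ B.thi →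
    σ * u < p₀ → 0 < σ → 0 < u → σ * u ≤ 1 → 0 < ε → ε ≤ 1 → 0 < θ → θ ≤ 1 →
    ∀ (a0 a1 At B1 B2 c0 c1 D : ℝ), 0 ≤ a0 → 0 ≤ a1 → 0 ≤ At → 0 ≤ B1 → 0 ≤ B2 → 0 ≤ c0 → 0 ≤ c1 → 0 ≤ D →
    0 ≤ (σ * D * (a0 + a1 + σ * u * (ε * θ * At)) - B1 * (u * B2 + (c0 + c1))) →
    0 ≤ (σ * D * (a0 + a1 + σ * u * (ε * θ * At)) - B2 * (u * B1 + (c0 + c1))) →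
    0 ≤ (σ * D * (a0 + a1 + σ * u * (ε * θ * At)) - (c0 + c1) * (B1 + B2)) →
    0 ≤ (σ * D * (a0 + u * B1 + u * B2 + c0) - B1 * (a1 + σ * u * (ε * θ * At) + c1 + σ * u * D)) →
    0 ≤ (σ * D * (a0 + u * B1 + u * B2 + c0) - B2 * (a1 + σ * u * (ε * θ * At) + c1 + σ * u * D)) →
    0 ≤ ((c1 + σ * u * D) * (a0 + u * B1 + u * B2 + c0) - c0 * (a1 + σ * u * (ε * θ * At) + c1 + σ * u * D)) →
    0 < ε * a0 + (-(1 - σ * u)) * At + ε * c0 + (-((1 - σ * u) * ε)) * D →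
    0 < (-(σ * (1 - θ * ε))) * a0 + (-σ) * a1 + (-(σ * θ * (1 - σ * u * (1 - ε)))) * At + (1 - σ * u) * B1 + (-(1 - (1 - σ * u) * (θ * ε))) * B2 + (-(σ * ε * θ)) * c1 →
    0 < (-(σ * (1 - ε))) * a0 + (-σ) * a1 + (-(σ * (1 - σ * u * (1 - θ * ε)))) * At + (-(1 - (1 - σ * u) * ε)) * B1 + (1 - σ * u) * B2 + (-(σ * ε)) * c1 →
    0 < (-(σ * (1 - ε) * (θ * ε))) * a0 + (1 - σ * u * (1 - θ * ε) - σ * θ * ε) * a1 + (-((σ * u + (1 - σ * u) * (1 - ε)) * (θ * ε))) * B1 + (-((σ * u + (1 - σ * u) * (1 - θ * ε)) * ε)) * B2 + (1 - σ * u * (1 - ε * ε * θ) - σ * (ε * ε * θ)) * c1 →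
    0 < (σ * u * (3 - ε - θ * ε) + σ * (1 - θ * ε) - 2) * a0 + (σ * u * (2 - ε) + σ * (1 - θ * ε) - 1) * a1 + (ε * θ * (σ * (σ * u * u * (3 - ε - θ * ε) + 1 - 2 * u))) * At + ((σ * u + (1 - σ * u) * (1 - ε)) * (1 - θ * ε) * (1 + u) - (1 - σ * u) * ε * u) * B1 + ((σ * u + (1 - σ * u) * (1 - θ * ε)) * (1 - ε) * (1 + u) - (1 - σ * u) * (θ * ε) * u) * B2 + (σ * u + (σ + 2 * (σ * u)) * (1 - ε * ε * θ) - 2) * c0 + (σ * u + (σ + σ * u) * (1 - ε * ε * θ) - 1) * c1 + (σ + σ * u - σ * u * ((1 - σ * u) * (ε * ε * θ))) * D →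
    False
  | 0, t, B, hcov => by simp [covers] at hcov
  | fuel + 1, Tree.leaf c, B, hcov => by
    intro σ u ε θ hslo hshi hulo huhi h1lo h1hi h2lo h2hi hp hσ0 hu0 hσu hε0 hε1 hθ0 hθ1
    simp only [covers, Bool.and_eq_true] at hcov
    exact cert_apply c B hcov.1 hcov.2 σ u ε θ hslo hshi hulo huhi h1lo h1hi h2lo h2hi hσ0 hu0 hσu hε0 hε1 hθ0 hθ1
  | fuel + 1, Tree.skip, B, hcov => by
    intro σ u ε θ hslo hshi hulo huhi h1lo h1hi h2lo h2hi hp hσ0 hu0 hσu hε0 hε1 hθ0 hθ1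
    exfalso
    simp only [covers, decide_eq_true_eq] at hcov
    obtain ⟨hs, hu, hpp⟩ := hcov
    have hs' : (0 : ℝ) ≤ (B.slo : ℝ) := by exact_mod_cast hs
    have hu' : (0 : ℝ) ≤ (B.ulo : ℝ) := by exact_mod_cast hu
    have hpp' : ((p₀ : ℚ) : ℝ) ≤ (B.slo : ℝ) * (B.ulo : ℝ) := by exact_mod_cast hpp
    have hm : (B.slo : ℝ) * (B.ulo : ℝ) ≤ σ * u := mul_le_mul hslo hulo hu' hσ0.le
    linarith
  | fuel + 1, Tree.node ax t tlo thi, B, hcov => by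
    intro σ u ε θ hslo hshi hulo huhi h1lo h1hi h2lo h2hi hp hσ0 hu0 hσu hε0 hε1 hθ0 hθ1
    simp only [covers, Bool.and_eq_true] at hcov
    obtain ⟨hclo, hchi⟩ := hcov
    have ihlo := tree_sound p₀ fuel tlo (B.cut ax t true) hclo σ u ε θ
    have ihhi := tree_sound p₀ fuel thi (B.cut ax t false) hchi σ u ε θ
    rcases Nat.lt_or_ge ax 1 with hax | hax
    · have hax0 : ax = 0 := by omega
      subst hax0
      rcases le_total σ (t : ℝ) with hle | hge
      · exact ihlo (by simpa [QBox4.cut] using hslo) (by simpa [QBox4.cut] using hle) (by simpa [QBox4.cut] using hulo)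
          (by simpa [QBox4.cut] using huhi) (by simpa [QBox4.cut] using h1lo) (by simpa [QBox4.cut] using h1hi)
          (by simpa [QBox4.cut] using h2lo) (by simpa [QBox4.cut] using h2hi) hp hσ0 hu0 hσu hε0 hε1 hθ0 hθ1
      · exact ihhi (by simpa [QBox4.cut] using hge) (by simpa [QBox4.cut] using hshi) (by simpa [QBox4.cut] using hulo)
          (by simpa [QBox4.cut] using huhi) (by simpa [QBox4.cut] using h1lo) (by simpa [QBox4.cut] using h1hi)
          (by simpa [QBox4.cut] using h2lo) (by simpa [QBox4.cut] using h2hi) hp hσ0 hu0 hσu hε0 hε1 hθ0 hθ1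
    · rcases Nat.lt_or_ge ax 2 with hax1 | hax2
      · have hax1' : ax = 1 := by omega
        subst hax1'
        rcases le_total u (t : ℝ) with hle | hge
        · exact ihlo (by simpa [QBox4.cut] using hslo) (by simpa [QBox4.cut] using hshi) (by simpa [QBox4.cut] using hulo)
            (by simpa [QBox4.cut] using hle) (by simpa [QBox4.cut] using h1lo) (by simpa [QBox4.cut] using h1hi)
            (by simpa [QBox4.cut] using h2lo) (by simpa [QBox4.cut] using h2hi) hp hσ0 hu0 hσu hε0 hε1 hθ0 hθ1
        · exact ihhi (by simpa [QBox4.cut] using hslo) (by simpa [QBox4.cut] using hshi) (by simpa [QBox4.cut] using hge)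
            (by simpa [QBox4.cut] using huhi) (by simpa [QBox4.cut] using h1lo) (by simpa [QBox4.cut] using h1hi)
            (by simpa [QBox4.cut] using h2lo) (by simpa [QBox4.cut] using h2hi) hp hσ0 hu0 hσu hε0 hε1 hθ0 hθ1
      · rcases Nat.lt_or_ge ax 3 with hax2' | hax3
        · have hax2'' : ax = 2 := by omega
          subst hax2''
          rcases le_total ε (t : ℝ) with hle | hge
          · exact ihlo (by simpa [QBox4.cut] using hslo) (by simpa [QBox4.cut] using hshi) (by simpa [QBox4.cut] using hulo)
              (by simpa [QBox4.cut] using huhi) (by simpa [QBox4.cut] using h1lo) (by simpa [QBox4.cut] using hle)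
              (by simpa [QBox4.cut] using h2lo) (by simpa [QBox4.cut] using h2hi) hp hσ0 hu0 hσu hε0 hε1 hθ0 hθ1
          · exact ihhi (by simpa [QBox4.cut] using hslo) (by simpa [QBox4.cut] using hshi) (by simpa [QBox4.cut] using hulo)
              (by simpa [QBox4.cut] using huhi) (by simpa [QBox4.cut] using hge) (by simpa [QBox4.cut] using h1hi)
              (by simpa [QBox4.cut] using h2lo) (by simpa [QBox4.cut] using h2hi) hp hσ0 hu0 hσu hε0 hε1 hθ0 hθ1
        · obtain ⟨m, hm⟩ : ∃ m, ax = m + 3 := ⟨ax - 3, by omega⟩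
          subst hm
          rcases le_total θ (t : ℝ) with hle | hge
          · exact ihlo (by simpa [QBox4.cut] using hslo) (by simpa [QBox4.cut] using hshi) (by simpa [QBox4.cut] using hulo)
              (by simpa [QBox4.cut] using huhi) (by simpa [QBox4.cut] using h1lo) (by simpa [QBox4.cut] using h1hi)
              (by simpa [QBox4.cut] using h2lo) (by simpa [QBox4.cut] using hle) hp hσ0 hu0 hσu hε0 hε1 hθ0 hθ1
          · exact ihhi (by simpa [QBox4.cut] using hslo) (by simpa [QBox4.cut] using hshi) (by simpa [QBox4.cut] using hulo)
              (by simpa [QBox4.cut] using huhi) (by simpa [QBox4.cut] using h1lo) (by simpa [QBox4.cut] using h1hi)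
              (by simpa [QBox4.cut] using hge) (by simpa [QBox4.cut] using h2hi) hp hσ0 hu0 hσu hε0 hε1 hθ0 hθ1

/-- The chart-D system is infeasible on the part `σu < p₀`, `0 < σ`, `0 < u`, `σu ≤ 1`, `0 < ε ≤ 1`, `0 < θ ≤ 1` of the rational box `B` (the shape of
every region / leaf theorem of the chart-D data files). -/
def BoxOKD (p₀ : ℚ) (B : QBox4) : Prop := ∀ (σ u ε θ : ℝ),
    (B.slo : ℝ) ≤ σ → σ ≤ B.shi → (B.ulo : ℝ) ≤ u → u ≤ B.uhi → (B.elo : ℝ) ≤ ε → ε ≤ B.ehi → (B.tlo : ℝ) ≤ θ → θ ≤ B.thi →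
    σ * u < p₀ → 0 < σ → 0 < u → σ * u ≤ 1 → 0 < ε → ε ≤ 1 → 0 < θ → θ ≤ 1 →
    ∀ (a0 a1 At B1 B2 c0 c1 D : ℝ), 0 ≤ a0 → 0 ≤ a1 → 0 ≤ At → 0 ≤ B1 → 0 ≤ B2 → 0 ≤ c0 → 0 ≤ c1 → 0 ≤ D →
    0 ≤ (σ * D * (a0 + a1 + σ * u * (ε * θ * At)) - B1 * (u * B2 + (c0 + c1))) →
    0 ≤ (σ * D * (a0 + a1 + σ * u * (ε * θ * At)) - B2 * (u * B1 + (c0 + c1))) →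
    0 ≤ (σ * D * (a0 + a1 + σ * u * (ε * θ * At)) - (c0 + c1) * (B1 + B2)) →
    0 ≤ (σ * D * (a0 + u * B1 + u * B2 + c0) - B1 * (a1 + σ * u * (ε * θ * At) + c1 + σ * u * D)) →
    0 ≤ (σ * D * (a0 + u * B1 + u * B2 + c0) - B2 * (a1 + σ * u * (ε * θ * At) + c1 + σ * u * D)) →
    0 ≤ ((c1 + σ * u * D) * (a0 + u * B1 + u * B2 + c0) - c0 * (a1 + σ * u * (ε * θ * At) + c1 + σ * u * D)) →
    0 < ε * a0 + (-(1 - σ * u)) * At + ε * c0 + (-((1 - σ * u) * ε)) * D →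
    0 < (-(σ * (1 - θ * ε))) * a0 + (-σ) * a1 + (-(σ * θ * (1 - σ * u * (1 - ε)))) * At + (1 - σ * u) * B1 + (-(1 - (1 - σ * u) * (θ * ε))) * B2 + (-(σ * ε * θ)) * c1 →
    0 < (-(σ * (1 - ε))) * a0 + (-σ) * a1 + (-(σ * (1 - σ * u * (1 - θ * ε)))) * At + (-(1 - (1 - σ * u) * ε)) * B1 + (1 - σ * u) * B2 + (-(σ * ε)) * c1 →
    0 < (-(σ * (1 - ε) * (θ * ε))) * a0 + (1 - σ * u * (1 - θ * ε) - σ * θ * ε) * a1 + (-((σ * u + (1 - σ * u) * (1 - ε)) * (θ * ε))) * B1 + (-((σ * u + (1 - σ * u) * (1 - θ * ε)) * ε)) * B2 + (1 - σ * u * (1 - ε * ε * θ) - σ * (ε * ε * θ)) * c1 →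
    0 < (σ * u * (3 - ε - θ * ε) + σ * (1 - θ * ε) - 2) * a0 + (σ * u * (2 - ε) + σ * (1 - θ * ε) - 1) * a1 + (ε * θ * (σ * (σ * u * u * (3 - ε - θ * ε) + 1 - 2 * u))) * At + ((σ * u + (1 - σ * u) * (1 - ε)) * (1 - θ * ε) * (1 + u) - (1 - σ * u) * ε * u) * B1 + ((σ * u + (1 - σ * u) * (1 - θ * ε)) * (1 - ε) * (1 + u) - (1 - σ * u) * (θ * ε) * u) * B2 + (σ * u + (σ + 2 * (σ * u)) * (1 - ε * ε * θ) - 2) * c0 + (σ * u + (σ + σ * u) * (1 - ε * ε * θ) - 1) * c1 + (σ + σ * u - σ * u * ((1 - σ * u) * (ε * ε * θ))) * D →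
    False

/-- A covered box satisfies `BoxOKD`. -/
theorem boxOKD_of_covers (p₀ : ℚ) (fuel : ℕ) (t : Tree) (B : QBox4) (h : covers p₀ fuel t B = true) : BoxOKD p₀ B :=
  tree_sound p₀ fuel t B h

/-- The same statement with `p₀` and the eight box bounds as real parameters (the shape used by the dispatch theorems). -/
def BoxOKDR (p₀ slo shi ulo uhi elo ehi tlo thi : ℝ) : Prop := ∀ (σ u ε θ : ℝ),
    slo ≤ σ → σ ≤ shi → ulo ≤ u → u ≤ uhi → elo ≤ ε → ε ≤ ehi → tlo ≤ θ → θ ≤ thi →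
    σ * u < p₀ → 0 < σ → 0 < u → σ * u ≤ 1 → 0 < ε → ε ≤ 1 → 0 < θ → θ ≤ 1 →
    ∀ (a0 a1 At B1 B2 c0 c1 D : ℝ), 0 ≤ a0 → 0 ≤ a1 → 0 ≤ At → 0 ≤ B1 → 0 ≤ B2 → 0 ≤ c0 → 0 ≤ c1 → 0 ≤ D →
    0 ≤ (σ * D * (a0 + a1 + σ * u * (ε * θ * At)) - B1 * (u * B2 + (c0 + c1))) →
    0 ≤ (σ * D * (a0 + a1 + σ * u * (ε * θ * At)) - B2 * (u * B1 + (c0 + c1))) →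
    0 ≤ (σ * D * (a0 + a1 + σ * u * (ε * θ * At)) - (c0 + c1) * (B1 + B2)) →
    0 ≤ (σ * D * (a0 + u * B1 + u * B2 + c0) - B1 * (a1 + σ * u * (ε * θ * At) + c1 + σ * u * D)) →
    0 ≤ (σ * D * (a0 + u * B1 + u * B2 + c0) - B2 * (a1 + σ * u * (ε * θ * At) + c1 + σ * u * D)) →
    0 ≤ ((c1 + σ * u * D) * (a0 + u * B1 + u * B2 + c0) - c0 * (a1 + σ * u * (ε * θ * At) + c1 + σ * u * D)) →
    0 < ε * a0 + (-(1 - σ * u)) * At + ε * c0 + (-((1 - σ * u) * ε)) * D →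
    0 < (-(σ * (1 - θ * ε))) * a0 + (-σ) * a1 + (-(σ * θ * (1 - σ * u * (1 - ε)))) * At + (1 - σ * u) * B1 + (-(1 - (1 - σ * u) * (θ * ε))) * B2 + (-(σ * ε * θ)) * c1 →
    0 < (-(σ * (1 - ε))) * a0 + (-σ) * a1 + (-(σ * (1 - σ * u * (1 - θ * ε)))) * At + (-(1 - (1 - σ * u) * ε)) * B1 + (1 - σ * u) * B2 + (-(σ * ε)) * c1 →
    0 < (-(σ * (1 - ε) * (θ * ε))) * a0 + (1 - σ * u * (1 - θ * ε) - σ * θ * ε) * a1 + (-((σ * u + (1 - σ * u) * (1 - ε)) * (θ * ε))) * B1 + (-((σ * u + (1 - σ * u) * (1 - θ * ε)) * ε)) * B2 + (1 - σ * u * (1 - ε * ε * θ) - σ * (ε * ε * θ)) * c1 →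
    0 < (σ * u * (3 - ε - θ * ε) + σ * (1 - θ * ε) - 2) * a0 + (σ * u * (2 - ε) + σ * (1 - θ * ε) - 1) * a1 + (ε * θ * (σ * (σ * u * u * (3 - ε - θ * ε) + 1 - 2 * u))) * At + ((σ * u + (1 - σ * u) * (1 - ε)) * (1 - θ * ε) * (1 + u) - (1 - σ * u) * ε * u) * B1 + ((σ * u + (1 - σ * u) * (1 - θ * ε)) * (1 - ε) * (1 + u) - (1 - σ * u) * (θ * ε) * u) * B2 + (σ * u + (σ + 2 * (σ * u)) * (1 - ε * ε * θ) - 2) * c0 + (σ * u + (σ + σ * u) * (1 - ε * ε * θ) - 1) * c1 + (σ + σ * u - σ * u * ((1 - σ * u) * (ε * ε * θ))) * D →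
    False

/-- `BoxOKD p₀ B` is `BoxOKDR` of the cast bounds. -/
theorem boxOKDR_of_boxOKD (p₀ : ℚ) (B : QBox4) (h : BoxOKD p₀ B) : BoxOKDR (p₀ : ℝ) B.slo B.shi B.ulo B.uhi B.elo B.ehi B.tlo B.thi :=
  h

end ChartD

end Quant

end Summit.CriticalPhenomena.PercolationContinuityZ3.Theorems
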